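import Mathlib
import Summits.KontsevichZagierPeriods.KontsevichZagierPeriods.Theorems.SoloInformedDefMoveIntegrandAddI
import Summits.KontsevichZagierPeriods.KontsevichZagierPeriods.Theorems.SoloInformedDefMoveDomainAdd
import HarnessLib

/-!
# Solo-informed (A390-ii): generator definability for ARBITRARY chains, II — the
domain-additivity move (1a)

File F6h.  Conditional on the Lion–Rolin preparation fact, every (unbounded) domain-additivity
move `[r] − [r₁] − [r₂] ∈ KZOver.domainAddRel ℝ` satisfies the definability invariant
`SoloInformedDefinableRelI` (`soloInformed_definableRelI_domainAddRel`).  The good set is cut out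
by I-admissibility (KERNEL LEMMA I), the union clause, the null-overlap (thin) clause and the two
graph-agreement clauses of `SoloInformedDefMoveDomainAdd`.

References: [cite: KontsevichZagier2001, §1.2 rule (1)]; [cite: BochnakCosteRoy1998, Prop. 2.2.4];
[cite: ComteLionRolin2000, Thm. 3].
-/

noncomputable section

open Set MeasureTheory MvPolynomial Literature.ModelTheory.ExponentialFields
  Literature.NumberTheory.Transcendental

namespace Summit.KontsevichZagierPeriods.KontsevichZagierPeriods.Theorems

/-- The (1a) move over `k` from its side conditions read on base changes to `ℝ`.
[cite: KontsevichZagier2001, §1.2 rule (1)] -/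
theorem soloInformed_mem_domainAddRel_of_baseChange {k : Type*} [Field k] [Algebra k ℝ]
    {n : ℕ} {x y z : KZOver.IntegralRep k n} {A A₁ A₂ : KZOver.IntegralRep ℝ n}
    (hx : x.baseChange ℝ = A) (hy : y.baseChange ℝ = A₁) (hz : z.baseChange ℝ = A₂)
    (hd : A.domain = A₁.domain ∪ A₂.domain) (h0 : volume (A₁.domain ∩ A₂.domain) = 0)
    (he₁ : EqOn A.integrand A₁.integrand A₁.domain)
    (he₂ : EqOn A.integrand A₂.integrand A₂.domain) :
    KZOver.of x - KZOver.of y - KZOver.of z ∈ KZOver.domainAddRel k := by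
  subst hx hy hz
  exact ⟨n, x, y, z, hd, h0, he₁, he₂, rfl⟩

/-- **Definability of the domain-additivity move (1a), arbitrary representations** (conditional
on the preparation fact). [cite: KontsevichZagier2001, §1.2 rule (1)] -/
theorem soloInformed_definableRelI_of_mem_domainAddRel (hprep : semialgebraicPreparation)
    {c : KZOver.FormalRep ℝ} (hc : c ∈ KZOver.domainAddRel ℝ) : SoloInformedDefinableRelI c := by
  classical
  obtain ⟨n, r, r₁, r₂, hd, h0, he₁, he₂, rfl⟩ := hc
  obtain ⟨K₀, _, T₀, p₀, hA₀, hrep₀, -⟩ := soloInformed_exists_pterm_repI r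
  obtain ⟨K₁, _, T₁, p₁, hA₁, hrep₁, -⟩ := soloInformed_exists_pterm_repI r₁
  obtain ⟨K₂, _, T₂, p₂, hA₂, hrep₂, -⟩ := soloInformed_exists_pterm_repI r₂
  -- common parameter space
  let θ₀ : K₀ → (K₀ ⊕ K₁) ⊕ K₂ := fun i => Sum.inl (Sum.inl i)
  let θ₁ : K₁ → (K₀ ⊕ K₁) ⊕ K₂ := fun i => Sum.inl (Sum.inr i)
  let θ₂ : K₂ → (K₀ ⊕ K₁) ⊕ K₂ := Sum.inr
  let T := T₀.pullback θ₀
  let U₁ := T₁.pullback θ₁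
  let U₂ := T₂.pullback θ₂
  let q : (K₀ ⊕ K₁) ⊕ K₂ → ℝ := Sum.elim (Sum.elim p₀ p₁) p₂
  have hq₀ : q ∘ θ₀ = p₀ := rfl
  have hq₁ : q ∘ θ₁ = p₁ := rfl
  have hq₂ : q ∘ θ₂ = p₂ := Sum.elim_comp_inr _ _
  have hTrep : ∀ p, T.repI p = T₀.repI (p ∘ θ₀) := fun p => SoloInformedPTerm.repI_pullback _ _ _
  have hU₁rep : ∀ p, U₁.repI p = T₁.repI (p ∘ θ₁) := fun p =>
    SoloInformedPTerm.repI_pullback _ _ _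
  have hU₂rep : ∀ p, U₂.repI p = T₂.repI (p ∘ θ₂) := fun p =>
    SoloInformedPTerm.repI_pullback _ _ _
  have hTadm : ∀ p, T.SoloInformedAdmI p ↔ T₀.SoloInformedAdmI (p ∘ θ₀) := fun p =>
    SoloInformedPTerm.admI_pullback_iff _ _ _
  have hU₁adm : ∀ p, U₁.SoloInformedAdmI p ↔ T₁.SoloInformedAdmI (p ∘ θ₁) := fun p =>
    SoloInformedPTerm.admI_pullback_iff _ _ _
  have hU₂adm : ∀ p, U₂.SoloInformedAdmI p ↔ T₂.SoloInformedAdmI (p ∘ θ₂) := fun p =>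
    SoloInformedPTerm.admI_pullback_iff _ _ _
  -- the good set
  let V : Set ((K₀ ⊕ K₁) ⊕ K₂ → ℝ) := {p | T.SoloInformedAdmI p ∧ U₁.SoloInformedAdmI p ∧
    U₂.SoloInformedAdmI p ∧ T.fibre p = U₁.fibre p ∪ U₂.fibre p ∧
    SoloInformedPTerm.SoloInformedThinPair U₁ U₂ p ∧
    SoloInformedPTerm.SoloInformedSubClause T U₁ p ∧ SoloInformedPTerm.SoloInformedSubClause T U₂ p}
  have hV : IsSemialgebraic ℚ V :=
    soloInformed_isSemialgebraic_setOf_and (T.isSemialgebraic_setOf_admI hprep)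
      (soloInformed_isSemialgebraic_setOf_and (U₁.isSemialgebraic_setOf_admI hprep)
      (soloInformed_isSemialgebraic_setOf_and (U₂.isSemialgebraic_setOf_admI hprep)
      (soloInformed_isSemialgebraic_setOf_and
        (SoloInformedPTerm.isSemialgebraic_setOf_fibre_eq_union _ _ _)
      (soloInformed_isSemialgebraic_setOf_and
        (SoloInformedPTerm.isSemialgebraic_setOf_thinPair _ _)
      (soloInformed_isSemialgebraic_setOf_and (SoloInformedPTerm.isSemialgebraic_setOf_subClause _ _)
      (SoloInformedPTerm.isSemialgebraic_setOf_subClause _ _))))))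
  -- side conditions on `V`
  have hside : ∀ p ∈ V, (T.repI p).domain = (U₁.repI p).domain ∪ (U₂.repI p).domain ∧
      volume ((U₁.repI p).domain ∩ (U₂.repI p).domain) = 0 ∧
      EqOn (T.repI p).integrand (U₁.repI p).integrand (U₁.repI p).domain ∧
      EqOn (T.repI p).integrand (U₂.repI p).integrand (U₂.repI p).domain := by
    rintro p ⟨hT, h₁, h₂, hu, hth, hc₁, hc₂⟩
    rw [SoloInformedPTerm.repI_domain hT, SoloInformedPTerm.repI_domain h₁,
      SoloInformedPTerm.repI_domain h₂, SoloInformedPTerm.repI_integrand hT,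
      SoloInformedPTerm.repI_integrand h₁, SoloInformedPTerm.repI_integrand h₂]
    refine ⟨hu, SoloInformedPTerm.thinPair_iff_volume_eq_zero.1 hth, fun x hx => ?_,
      fun x hx => ?_⟩
    · have hxT : x ∈ T.fibre p := hu ▸ Or.inl hx
      rw [SoloInformedPTerm.hybrid_of_mem hxT, SoloInformedPTerm.hybrid_of_mem hx]
      exact SoloInformedPTerm.gval_eq_of_subClause hc₁ hT.1 h₁.1 hxT hx
    · have hxT : x ∈ T.fibre p := hu ▸ Or.inr hx
      rw [SoloInformedPTerm.hybrid_of_mem hxT, SoloInformedPTerm.hybrid_of_mem hx]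
      exact SoloInformedPTerm.gval_eq_of_subClause hc₂ hT.1 h₂.1 hxT hx
  refine ⟨(K₀ ⊕ K₁) ⊕ K₂, inferInstance, SoloInformedPCombo.three T U₁ U₂, q, V, hV, ?_, ?_, ?_, ?_⟩
  · -- the original parameter is good
    have hT : T.SoloInformedAdmI q := (hTadm q).2 (hq₀ ▸ hA₀)
    have h₁ : U₁.SoloInformedAdmI q := (hU₁adm q).2 (hq₁ ▸ hA₁)
    have h₂ : U₂.SoloInformedAdmI q := (hU₂adm q).2 (hq₂ ▸ hA₂)
    have hTq : T.repI q = r := by rw [hTrep, hq₀, hrep₀]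
    have h₁q : U₁.repI q = r₁ := by rw [hU₁rep, hq₁, hrep₁]
    have h₂q : U₂.repI q = r₂ := by rw [hU₂rep, hq₂, hrep₂]
    have hfT : T.fibre q = r.domain := by rw [← SoloInformedPTerm.repI_domain hT, hTq]
    have hf₁ : U₁.fibre q = r₁.domain := by rw [← SoloInformedPTerm.repI_domain h₁, h₁q]
    have hf₂ : U₂.fibre q = r₂.domain := by rw [← SoloInformedPTerm.repI_domain h₂, h₂q]
    refine ⟨hT, h₁, h₂, by rw [hfT, hf₁, hf₂, hd], ?_, ?_, ?_⟩
    · exact SoloInformedPTerm.thinPair_iff_volume_eq_zero.2 (by rw [hf₁, hf₂]; exact h0)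
    · refine SoloInformedPTerm.subClause_of_graphs (g := r.integrand) (gU := r₁.integrand)
        (fun x hx t => ?_) (fun x hx t => ?_) (fun x hx => he₁ (hf₁ ▸ hx))
      · rw [SoloInformedPTerm.snoc_mem_gfibre_iff_of_admI hT
          (hfT.symm ▸ hd.symm ▸ Or.inl (hf₁ ▸ hx)), hTq]
      · rw [SoloInformedPTerm.snoc_mem_gfibre_iff_of_admI h₁ hx, h₁q]
    · refine SoloInformedPTerm.subClause_of_graphs (g := r.integrand) (gU := r₂.integrand)
        (fun x hx t => ?_) (fun x hx t => ?_) (fun x hx => he₂ (hf₂ ▸ hx))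
      · rw [SoloInformedPTerm.snoc_mem_gfibre_iff_of_admI hT
          (hfT.symm ▸ hd.symm ▸ Or.inr (hf₂ ▸ hx)), hTq]
      · rw [SoloInformedPTerm.snoc_mem_gfibre_iff_of_admI h₂ hx, h₂q]
  · -- it denotes `c`
    rw [SoloInformedPCombo.comboI_three, hTrep, hU₁rep, hU₂rep, hq₀, hq₁, hq₂, hrep₀, hrep₁,
      hrep₂]
  · -- every good parameter denotes a (1a) move over `ℝ`
    rintro p hp
    obtain ⟨hd', h0', he₁', he₂'⟩ := hside p hp
    obtain ⟨hT, h₁, h₂, -⟩ := hp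
    refine ⟨SoloInformedPCombo.admI_three hT h₁ h₂, ?_⟩
    rw [SoloInformedPCombo.comboI_three]
    exact KZOver.domainAddRel_subset_relations
      (soloInformed_mem_domainAddRel_of_baseChange (soloInformed_baseChange_real _)
        (soloInformed_baseChange_real _) (soloInformed_baseChange_real _) hd' h0' he₁' he₂')
  · -- rational lift at parameters with rational fibres
    rintro p hp hRF
    obtain ⟨hd', h0', he₁', he₂'⟩ := hside p hp
    obtain ⟨hT, h₁, h₂, -⟩ := hp
    obtain ⟨hS₀, hG₀⟩ := soloInformedRatFibres.fibre hRF T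
    obtain ⟨hS₁, hG₁⟩ := soloInformedRatFibres.fibre hRF U₁
    obtain ⟨hS₂, hG₂⟩ := soloInformedRatFibres.fibre hRF U₂
    refine SoloInformedPCombo.ratLiftI_three (SoloInformedPTerm.ratRepI hS₀ hG₀ hT)
      (SoloInformedPTerm.ratRepI hS₁ hG₁ h₁) (SoloInformedPTerm.ratRepI hS₂ hG₂ h₂)
      (SoloInformedPTerm.baseChange_ratRepI _ _ _) (SoloInformedPTerm.baseChange_ratRepI _ _ _)
      (SoloInformedPTerm.baseChange_ratRepI _ _ _) ?_
    exact KZOver.domainAddRel_subset_relations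
      (soloInformed_mem_domainAddRel_of_baseChange
        (SoloInformedPTerm.baseChange_ratRepI _ _ _) (SoloInformedPTerm.baseChange_ratRepI _ _ _)
        (SoloInformedPTerm.baseChange_ratRepI _ _ _) hd' h0' he₁' he₂')

/-- **The (1a) hypothesis of THEOREM R / T for arbitrary chains, discharged** (conditional on the
preparation fact). [cite: KontsevichZagier2001, §1.2] -/
theorem soloInformed_definableRelI_domainAddRel (hprep : semialgebraicPreparation) :
    ∀ c ∈ KZOver.domainAddRel ℝ, SoloInformedDefinableRelI c :=
  fun _ hc => soloInformed_definableRelI_of_mem_domainAddRel hprep hc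

end Summit.KontsevichZagierPeriods.KontsevichZagierPeriods.Theorems
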